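import Mathlib
import HarnessLib
import Summits.QuantumAdvantage.QuantumAdvantage.Theses.DyadicGap
import Literature.Computability.Complexity.Classes
import Literature.Computability.Complexity.ProbabilisticClassesProofs
import Literature.Computability.Complexity.CircuitLowerBoundsIW
import Literature.Computability.Cryptography.ToffoliHEncodable

/-!
# Line `dyadicgap-derandomization-cut` — skeleton for crux `DyadicGap.Target` (stmt-QuantumAdvantage-1840)

Strategist line (crux-strategist, BC2 redirect of a RESTATED deciding crux). The crux
`Target` = "∃ poly-time uniform oracle-free Toffoli+H family with polynomially quantized diagonal amplitudes whose sign
language is NOT in BPP" is cut along the DERANDOMIZATION seam, the one seam of `Target` that is a THEOREM of the tree: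

* `stub_qsignNotInP` (OPEN; = piece/child `QSignNotInP`): the same witness statement against `P` instead of `BPP` — strictly
  weaker than the crux modulo `P = BPP` (it is a consequence of the crux by `P_subset_BPP_holds`); its own birth skeleton is
  `Lines/dyadicgap_birth_QSignNotInP.lean` (exact-first: `CoExactIsQuantizedSign` + `EQP_{Toffoli+H} ⊄ P`);
* `stub_eHard` (OPEN, hypothesis-type, programme-wide; = piece/child `EHard`, the SAME statement as item `YbEHard`
  stmt-QuantumAdvantage-17622, birth skeleton `Cruxes/YbTarget/Lines/birth_YbEHard.lean`): `E ⊄ i.o.-SIZE(2^{εn})`, verbatim the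
  antecedent of the tree theorem `impagliazzo_wigderson_holds` (Impagliazzo–Wigderson 1997 Thm 2: ⟹ `P = BPP`);
* `Target_of` (kernel-checked, no sorry): `stub₁-statement → stub₂-statement → Theses.DyadicGap.Target` BY NAME — the seam is
  `impagliazzo_wigderson_holds` (the glue `Cruxes/Target/DyadicGapTargetSplit.lean :: target_of_subs` is this proof).

Typing note: the stub/hypothesis copies of piece 1 name the tree's CONSTANT instance `instEncodableOpToffoliH`
(ToffoliHEncodable.lean) where the route decl `Target` (and the child item `QSignNotInP`) inline `inferInstanceAs (Encodable ToffoliHOp)`: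
the two are definitionally equal by unfolding (the composition below type-checks against `Target` verbatim), but only the
constant is SYNTACTICALLY stable across occurrences, which the skeleton audit's by-name hypothesis matching requires.
Sorries: exactly 2, inside the two stubs. References: ImpagliazzoWigderson1997 Thm 2; NisanWigderson1994 Thm 3; AroraBarakCC2009
Thm 20.7; deBeaudrap2015 (exact/quantized classes inside LWPP).
-/

set_option linter.dupNamespace false

namespace Summit.QuantumAdvantage.QuantumAdvantage.Cruxes.Target.DyadicGapDerandomizationCut

open Literature.Computability.Complexity
open Summit.QuantumAdvantage.QuantumAdvantage.Theses.DyadicGap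

/-- **stub 1 (OPEN; piece `QSignNotInP`).** Some poly-time uniform oracle-free Toffoli+H family with polynomially quantized
diagonal amplitudes has its sign language outside `P`. -/
theorem stub_qsignNotInP : ∃ (F : Literature.Computability.Cryptography.QCircuitFamily Literature.Computability.Cryptography.toffoliH) (c : ℕ), F.IsOracleFree ∧ @Literature.Computability.Cryptography.QCircuitFamily.IsUniform Literature.Computability.Cryptography.toffoliH Literature.Computability.Cryptography.instEncodableOpToffoliH F ∧ (∀ x : List Bool, ∃ (q : ℕ) (k : ℤ), 2 ^ q ≤ (x.length + 2) ^ c ∧ ((F.circ x.length).mat (Literature.Computability.Cryptography.padInput x.get (F.ancillas x.length)) (Literature.Computability.Cryptography.padInput x.get (F.ancillas x.length))) = (k : ℂ) / (2 : ℂ) ^ q) ∧ ({x : List Bool | 0 < ((F.circ x.length).mat (Literature.Computability.Cryptography.padInput x.get (F.ancillas x.length)) (Literature.Computability.Cryptography.padInput x.get (F.ancillas x.length))).re} : Language Bool) ∉ Literature.Computability.Complexity.Classes.P := by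
  sorry

/-- **stub 2 (OPEN, hypothesis-type; piece `EHard` = item YbEHard, stmt-QuantumAdvantage-17622).** `E ⊄ i.o.-SIZE(2^{εn})`. -/
theorem stub_eHard : ∃ L ∈ Literature.Computability.Complexity.E, ∃ ε : ℝ, 0 < ε ∧ ∀ᶠ n : ℕ in Filter.atTop, (2 : ℝ) ^ (ε * n) ≤ (L.circuitSize n : ℝ) := by
  sorry

/-! ## Name-keyed aliases of the stub statements (the native skeleton audit admits a hypothesis of the composition only
if its head constant is a registered obligation or carries a declared stub's name; pattern of
`Cruxes/PlLift/Lines/certified_canonical_lift.lean`). -/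

namespace Registered

/-- Alias of stub 1's statement keyed by the registered stub name. -/
abbrev stub_qsignNotInP : Prop := ∃ (F : Literature.Computability.Cryptography.QCircuitFamily Literature.Computability.Cryptography.toffoliH) (c : ℕ), F.IsOracleFree ∧ @Literature.Computability.Cryptography.QCircuitFamily.IsUniform Literature.Computability.Cryptography.toffoliH Literature.Computability.Cryptography.instEncodableOpToffoliH F ∧ (∀ x : List Bool, ∃ (q : ℕ) (k : ℤ), 2 ^ q ≤ (x.length + 2) ^ c ∧ ((F.circ x.length).mat (Literature.Computability.Cryptography.padInput x.get (F.ancillas x.length)) (Literature.Computability.Cryptography.padInput x.get (F.ancillas x.length))) = (k : ℂ) / (2 : ℂ) ^ q) ∧ ({x : List Bool | 0 < ((F.circ x.length).mat (Literature.Computability.Cryptography.padInput x.get (F.ancillas x.length)) (Literature.Computability.Cryptography.padInput x.get (F.ancillas x.length))).re} : Language Bool) ∉ Literature.Computability.Complexity.Classes.P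
/-- Alias of stub 2's statement keyed by the registered stub name. -/
abbrev stub_eHard : Prop := ∃ L ∈ Literature.Computability.Complexity.E, ∃ ε : ℝ, 0 < ε ∧ ∀ᶠ n : ℕ in Filter.atTop, (2 : ℝ) ^ (ε * n) ≤ (L.circuitSize n : ℝ)

end Registered

/-- **Composition of the line** (kernel-checked, no sorry): the crux `Theses.DyadicGap.Target` BY NAME from the two stub
statements (name-keyed aliases, definitionally the stubs); the seam is the tree's Impagliazzo–Wigderson theorem.
[cite: ImpagliazzoWigderson1997, Thm 2] -/
theorem Target_of (h₁ : Registered.stub_qsignNotInP) (h₂ : Registered.stub_eHard) :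
    Summit.QuantumAdvantage.QuantumAdvantage.Theses.DyadicGap.Target := by
  have hPB : Classes.P = BPP := impagliazzo_wigderson_holds h₂
  obtain ⟨F, c, hof, hu, hq, hnP⟩ := h₁
  refine ⟨F, c, hof, hu, hq, fun hB => hnP ?_⟩
  rw [hPB]
  exact hB

/-- Wiring check: the registered stub theorems feed `Target_of` as stated (an unnamed `example`, so that `Target_of` stays the
only declaration concluding the crux by name; sorries only inside `stub_*`). -/
example : Summit.QuantumAdvantage.QuantumAdvantage.Theses.DyadicGap.Target := Target_of stub_qsignNotInP stub_eHard

end Summit.QuantumAdvantage.QuantumAdvantage.Cruxes.Target.DyadicGapDerandomizationCut
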